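import Literature.Analysis.FluidPDE.BarkerPrangeConcentrationLimit
import Literature.Analysis.FluidPDE.WeakL3CaloricExtension
import Literature.Analysis.FunctionSpaces.WeakLpQuantitative
import HarnessLib

/-!
# Caloric extensions of `L² + L^∞` data: symmetry, weak limits, the initial layer and the
# initial condition of limits (glue for blow-down sequences with weak-`L³` data)

Analysis/FluidPDE proof file (theorems only: no definition, no named fact, no `sorry`) on the
discharge path of the named fact
`Literature.Analysis.FluidPDE.AlbrittonBarker2019_liouville_weakL3_backward`
(`AncientL3BackwardLiouville.lean`; Albritton–Barker, arXiv:1811.00502, **Thm. 4.1**). The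
limiting procedure in the proof of Thm. 4.1 (p. 9: "`v^{(k)}(·,−1) ⇀* u(·,−1)` in `L^{3,∞}`",
then Barker–Seregin–Šverák's stability theorem, arXiv:1603.03211 Thm. 1.3, §3.2) is run in the
tree by Seregin's limiting procedure for local energy solutions
(`BarkerPrange2020.exists_limit_localEnergySolution_of_le` is the model), whose datum glue —
convergence of the caloric extensions `W_{νt} * a_n` against test fields, passage of the
uniform initial layer to the limit, the initial condition of the limit — is written there for
data in `L²(ℝ³)` / `L³(ℝ³)`. Weak-`L³` data are neither; but every weak-`L³` field, and the weak
limits extracted in `WeakL3DataWeakCompactness.lean`, lie in `L² + L^∞` (indeed `L² + L⁴ ∩ L^∞`,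
Barker–Seregin–Šverák 2018, Lemma 2.1: splitting at height one). This file proves the glue for
that class:

* `heatExtension_eq_add_of_ae_eq_add_memLp` — `e^{sΔ}a = e^{sΔ}g + e^{sΔ}h` for `a = g + h`
  a.e., `g ∈ Lᵖ`, `h ∈ L^q`;
* `integral_inner_heatExtension_comm_of_ae_eq_add` — symmetry `∫⟪e^{sΔ}a, φ⟫ = ∫⟪a, e^{sΔ}φ⟫`
  for `a ∈ L² + L^∞` and continuous compactly supported `φ`;
* `tendsto_integral_inner_heatTest_of_ae_eq_add` — the caloric extensions of a weakly
  convergent, uniformly locally square-bounded sequence of `L² + L^∞` fields converge against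
  test fields (through `BarkerPrange2020.tendsto_integral_inner_of_forall_ball_le`);
* `eLpNorm_sub_heatTest_le_of_tendsto_of_ae_eq_add` — the uniform initial layer passes to the
  weak limit (Lemarié-Rieusset 2016, p. 571);
* `tendsto_lintegral_sub_datum_of_layer_of_ae_eq_add` — the initial condition of the limit
  from the layer, for a limit datum in `L² + L⁴` (strong continuity of the heat semigroup on
  `L²` and on `L⁴`).

## References

* D. Albritton, T. Barker, arXiv:1811.00502, proof of Thm. 4.1 (p. 9). [`AlbrittonBarker2019`]
* T. Barker, G. Seregin, V. Šverák, arXiv:1603.03211, Lemma 2.1, §3.2. [`BarkerSeregin2016`]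
* P. G. Lemarié-Rieusset, *The Navier–Stokes Problem in the 21st Century* (2016), proof of
  Thm. 15.5, pp. 570–571. [`LemarieRieusset2016`]
* G. Seregin, *Lecture Notes on Regularity Theory for the Navier–Stokes Equations* (2014),
  Ch. 7 §7.3, App. B §B.4. [`Seregin2014`]
-/

noncomputable section

open MeasureTheory TopologicalSpace Set Function Filter Metric
open _root_.Topology
open scoped ENNReal NNReal RealInnerProductSpace

namespace Literature.Analysis.FluidPDE

local notation "ℝ³" => EuclideanSpace ℝ (Fin 3)

/-! ### Caloric extensions of `L^p + L^q` data -/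

/-- **Linearity of the caloric extension on an a.e. splitting**: if `a = g + h` a.e. with
`g ∈ Lᵖ`, `h ∈ L^q`, `1 ≤ p, q`, then `e^{sΔ}a = e^{sΔ}g + e^{sΔ}h` everywhere, `s > 0` (both
convolution integrals converge). [folklore] -/
theorem heatExtension_eq_add_of_ae_eq_add_memLp {a g h : ℝ³ → ℝ³} {p q : ℝ≥0∞} (hp : 1 ≤ p)
    (hq : 1 ≤ q) (hg : MemLp g p volume) (hh : MemLp h q volume) (hae : a =ᵐ[volume] g + h)
    {s : ℝ} (hs : 0 < s) :
    UnboundedOperators.heatExtension a s = fun x =>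
      UnboundedOperators.heatExtension g s x + UnboundedOperators.heatExtension h s x := by
  rw [UnboundedOperators.heatExtension_congr_ae' hae s]
  funext x
  exact ConvolutionExistsAt.distrib_add
    (convolutionExistsAt_heatKernel_of_memLp hg hp hs x)
    (convolutionExistsAt_heatKernel_of_memLp hh hq hs x)

/-- The caloric test field `W_{νt} * a` of an a.e. splitting, `t > 0`. [folklore] -/
theorem heatTest_eq_add_of_ae_eq_add_memLp {ν t : ℝ} (hν : 0 < ν) (ht : 0 < t)
    {a g h : ℝ³ → ℝ³} {p q : ℝ≥0∞} (hp : 1 ≤ p) (hq : 1 ≤ q) (hg : MemLp g p volume)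
    (hh : MemLp h q volume) (hae : a =ᵐ[volume] g + h) :
    heatTest ν a t = heatTest ν g t + heatTest ν h t := by
  rw [heatTest_of_pos hν ht, heatTest_of_pos hν ht, heatTest_of_pos hν ht,
    heatExtension_eq_add_of_ae_eq_add_memLp hp hq hg hh hae (mul_pos hν ht)]
  rfl

/-- Pairings of an `L²` field with an `L²` field are integrable. [folklore] -/
theorem integrable_inner_of_memLp_two_two {g φ : ℝ³ → ℝ³} (hg : MemLp g 2 volume)
    (hφ : MemLp φ 2 volume) : Integrable (fun x => ⟪g x, φ x⟫) volume :=
  integrable_inner_of_memLp_conj hg hφ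

/-- Pairings of an `L^∞` field with an `L¹` field are integrable. [folklore] -/
theorem integrable_inner_of_memLp_top_one {h φ : ℝ³ → ℝ³} (hh : MemLp h ∞ volume)
    (hφ : MemLp φ 1 volume) : Integrable (fun x => ⟪h x, φ x⟫) volume :=
  integrable_inner_of_memLp_conj hh hφ

/-- **Symmetry of the heat semigroup pairing for `L² + L^∞` data**: for `a = g + h` a.e. with
`g ∈ L²`, `h ∈ L^∞`, a continuous compactly supported `φ` and `s > 0`,
`∫⟪e^{sΔ}a, φ⟫ = ∫⟪a, e^{sΔ}φ⟫` (the two symmetric pairings `L² – L²` and `L^∞ – L¹` of the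
tree's `integral_inner_heatExtension_comm`). [folklore] -/
theorem integral_inner_heatExtension_comm_of_ae_eq_add {a g h : ℝ³ → ℝ³}
    (hg : MemLp g 2 volume) (hh : MemLp h ∞ volume) (hae : a =ᵐ[volume] g + h)
    {φ : ℝ³ → ℝ³} (hφ : Continuous φ) (hφc : HasCompactSupport φ) {s : ℝ} (hs : 0 < s) :
    ∫ x, ⟪UnboundedOperators.heatExtension a s x, φ x⟫ =
      ∫ x, ⟪a x, UnboundedOperators.heatExtension φ s x⟫ := by
  have hφ1 : MemLp φ 1 volume := hφ.memLp_of_hasCompactSupport hφc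
  have hφ2 : MemLp φ 2 volume := hφ.memLp_of_hasCompactSupport hφc
  have hSg : MemLp (UnboundedOperators.heatExtension g s) 2 volume :=
    UnboundedOperators.memLp_heatExtension_holds hg one_le_two hs
  have hSh : MemLp (UnboundedOperators.heatExtension h s) ∞ volume :=
    UnboundedOperators.memLp_heatExtension_holds hh le_top hs
  have hSφ1 : MemLp (UnboundedOperators.heatExtension φ s) 1 volume :=
    UnboundedOperators.memLp_heatExtension_holds hφ1 le_rfl hs
  have hSφ2 : MemLp (UnboundedOperators.heatExtension φ s) 2 volume :=
    UnboundedOperators.memLp_heatExtension_holds hφ2 one_le_two hs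
  rw [heatExtension_eq_add_of_ae_eq_add_memLp one_le_two le_top hg hh hae hs]
  calc ∫ x, ⟪UnboundedOperators.heatExtension g s x + UnboundedOperators.heatExtension h s x, φ x⟫
      = (∫ x, ⟪UnboundedOperators.heatExtension g s x, φ x⟫) +
          ∫ x, ⟪UnboundedOperators.heatExtension h s x, φ x⟫ := by
        rw [← integral_add (integrable_inner_of_memLp_two_two hSg hφ2)
          (integrable_inner_of_memLp_top_one hSh hφ1)]
        exact integral_congr_ae (Eventually.of_forall fun x => inner_add_left _ _ _)
    _ = (∫ x, ⟪g x, UnboundedOperators.heatExtension φ s x⟫) +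
          ∫ x, ⟪h x, UnboundedOperators.heatExtension φ s x⟫ := by
        rw [integral_inner_heatExtension_comm hg hφ2 hs, integral_inner_heatExtension_comm hh hφ1 hs]
    _ = ∫ x, ⟪g x + h x, UnboundedOperators.heatExtension φ s x⟫ := by
        rw [← integral_add (integrable_inner_of_memLp_two_two hg hSφ2)
          (integrable_inner_of_memLp_top_one hh hSφ1)]
        exact integral_congr_ae (Eventually.of_forall fun x => (inner_add_left _ _ _).symm)
    _ = ∫ x, ⟪a x, UnboundedOperators.heatExtension φ s x⟫ := by
        refine integral_congr_ae ?_
        filter_upwards [hae] with x hx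
        rw [hx, Pi.add_apply]

/-! ### Weak limits of caloric extensions -/

/-- **The caloric extensions of a weakly convergent, uniformly locally square-bounded sequence
of `L² + L^∞` fields converge against test fields**: if the `a n` and `aL` are of the form
`g + h` a.e. with `g ∈ L²`, `h ∈ L^∞`, have unit-ball energies `≤ A < ∞`, and
`∫⟪a n, ψ⟫ → ∫⟪aL, ψ⟫` for all test fields `ψ`, then `∫⟪W_{νt} * a n, g⟫ → ∫⟪W_{νt} * aL, g⟫`
for `ν, t > 0` and every test field `g` (symmetry of the heat semigroup, and
`BarkerPrange2020.tendsto_integral_inner_of_forall_ball_le` applied to the decaying smooth field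
`W_{νt} * g`). [folklore] -/
theorem tendsto_integral_inner_heatTest_of_ae_eq_add {a : ℕ → ℝ³ → ℝ³} {aL : ℝ³ → ℝ³}
    {A : ℝ≥0∞} (hAtop : A ≠ ∞)
    (ha : ∀ n, ∃ g h : ℝ³ → ℝ³, MemLp g 2 volume ∧ MemLp h ∞ volume ∧ a n =ᵐ[volume] g + h)
    (haA : ∀ n, ∀ z : ℝ³, ∫⁻ y in ball z 1, ‖a n y‖ₑ ^ 2 ≤ A)
    (haL : ∃ g h : ℝ³ → ℝ³, MemLp g 2 volume ∧ MemLp h ∞ volume ∧ aL =ᵐ[volume] g + h)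
    (haLA : ∀ z : ℝ³, ∫⁻ y in ball z 1, ‖aL y‖ₑ ^ 2 ≤ A)
    (h : ∀ ψ : ℝ³ → ℝ³, FunctionSpaces.IsTestFunctionOn (⊤ : Opens ℝ³) ψ →
      Tendsto (fun n => ∫ x, ⟪a n x, ψ x⟫) atTop (𝓝 (∫ x, ⟪aL x, ψ x⟫)))
    {ν t : ℝ} (hν : 0 < ν) (ht : 0 < t) {g : ℝ³ → ℝ³}
    (hg : FunctionSpaces.IsTestFunctionOn (⊤ : Opens ℝ³) g) :
    Tendsto (fun n => ∫ x, ⟪heatTest ν (a n) t x, g x⟫) atTop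
      (𝓝 (∫ x, ⟪heatTest ν aL t x, g x⟫)) := by
  have hνt : 0 < ν * t := mul_pos hν ht
  have ham : ∀ n, AEStronglyMeasurable (a n) volume := fun n => by
    obtain ⟨g', h', hg', hh', hae⟩ := ha n
    exact (hg'.1.add hh'.1).congr hae.symm
  have haLm : AEStronglyMeasurable aL volume := by
    obtain ⟨g', h', hg', hh', hae⟩ := haL
    exact (hg'.1.add hh'.1).congr hae.symm
  have e : ∀ {f : ℝ³ → ℝ³}, (∃ g' h' : ℝ³ → ℝ³, MemLp g' 2 volume ∧ MemLp h' ∞ volume ∧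
      f =ᵐ[volume] g' + h') →
      ∫ x, ⟪heatTest ν f t x, g x⟫ = ∫ x, ⟪f x, UnboundedOperators.heatExtension g (ν * t) x⟫ := by
    rintro f ⟨g', h', hg', hh', hae⟩
    rw [heatTest_of_pos hν ht]
    exact integral_inner_heatExtension_comm_of_ae_eq_add hg' hh' hae hg.contDiff.continuous
      hg.hasCompactSupport hνt
  have e' : (fun n => ∫ x, ⟪heatTest ν (a n) t x, g x⟫) =
      fun n => ∫ x, ⟪a n x, UnboundedOperators.heatExtension g (ν * t) x⟫ :=
    funext fun n => e (ha n)
  rw [e', e haL]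
  obtain ⟨B, -, hB⟩ := BarkerPrange2020.exists_norm_heatExtension_le_inv_one_add_pow hg.contDiff.continuous
    hg.hasCompactSupport hνt
  have hsm : ContDiff ℝ (⊤ : ℕ∞) (UnboundedOperators.heatExtension g (ν * t)) := by
    have h1 := contDiff_heatTest hg ν t
    rwa [heatTest_of_pos hν ht] at h1
  exact BarkerPrange2020.tendsto_integral_inner_of_forall_ball_le hAtop ham haA haLm haLA h hsm hB

/-! ### The initial layer passes to the limit -/

/-- The caloric extension `W_{νt} * a`, `t > 0`, of an `L² + L^∞` field is in `L²` of every unit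
ball. [folklore] -/
theorem memLp_two_heatTest_restrict_ball_of_ae_eq_add {ν t : ℝ} (hν : 0 < ν) (ht : 0 < t)
    {a g h : ℝ³ → ℝ³} (hg : MemLp g 2 volume) (hh : MemLp h ∞ volume)
    (hae : a =ᵐ[volume] g + h) (x₀ : ℝ³) :
    MemLp (heatTest ν a t) 2 (volume.restrict (ball x₀ 1)) := by
  haveI : IsFiniteMeasure (volume.restrict (ball x₀ (1 : ℝ))) :=
    ⟨by rw [Measure.restrict_apply_univ]; exact measure_ball_lt_top⟩
  rw [heatTest_eq_add_of_ae_eq_add_memLp hν ht one_le_two le_top hg hh hae]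
  have h2 : MemLp (heatTest ν g t) 2 volume :=
    memLp_heatFlow_holds hg one_le_two (mul_nonneg hν.le ht.le)
  have h4 : MemLp (heatTest ν h t) ∞ volume :=
    memLp_heatFlow_holds hh le_top (mul_nonneg hν.le ht.le)
  exact (h2.restrict _).add ((h4.restrict (ball x₀ 1)).mono_exponent le_top)

/-- **The uniform initial layer passes to the weak limit, `L² + L^∞` data** (Lemarié-Rieusset
2016, p. 571, "Thus, `‖v_∞(t,.) − W_{νt} * v_∞(0,.)‖_{L²_uloc} ≤ η(t)`"; the tree's
`BarkerPrange2020.eLpNorm_sub_heatTest_le_of_tendsto'` with the data classes `L²`, `L³`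
replaced by `L² + L^∞`): if `‖w n − W_{νt} * a n‖_{L²(B(x₀,1))} ≤ B` for all `n`, the data
have unit-ball energies `≤ A` and `a n → aL`, `w n → wL` against test fields, then
`‖wL − W_{νt} * aL‖_{L²(B(x₀,1))} ≤ B`. [cite: LemarieRieusset2016, proof of Thm. 15.5, p. 571] -/
theorem eLpNorm_sub_heatTest_le_of_tendsto_of_ae_eq_add {ν t : ℝ} (hν : 0 < ν) (ht : 0 < t)
    {A : ℝ≥0∞} (hAtop : A ≠ ∞) {B : ℝ≥0}
    {a : ℕ → ℝ³ → ℝ³} {aL : ℝ³ → ℝ³} {w : ℕ → ℝ³ → ℝ³} {wL : ℝ³ → ℝ³}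
    (ha : ∀ n, ∃ g h : ℝ³ → ℝ³, MemLp g 2 volume ∧ MemLp h ∞ volume ∧ a n =ᵐ[volume] g + h)
    (haA : ∀ n, ∀ z : ℝ³, ∫⁻ y in ball z 1, ‖a n y‖ₑ ^ 2 ≤ A)
    (haL : ∃ g h : ℝ³ → ℝ³, MemLp g 2 volume ∧ MemLp h ∞ volume ∧ aL =ᵐ[volume] g + h)
    (haLA : ∀ z : ℝ³, ∫⁻ y in ball z 1, ‖aL y‖ₑ ^ 2 ≤ A)
    (hconv0 : ∀ ψ : ℝ³ → ℝ³, FunctionSpaces.IsTestFunctionOn (⊤ : Opens ℝ³) ψ →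
      Tendsto (fun n => ∫ x, ⟪a n x, ψ x⟫) atTop (𝓝 (∫ x, ⟪aL x, ψ x⟫)))
    (hconv : ∀ ψ : ℝ³ → ℝ³, FunctionSpaces.IsTestFunctionOn (⊤ : Opens ℝ³) ψ →
      Tendsto (fun n => ∫ x, ⟪w n x, ψ x⟫) atTop (𝓝 (∫ x, ⟪wL x, ψ x⟫)))
    (x₀ : ℝ³) (hw2 : ∀ n, MemLp (w n) 2 (volume.restrict (ball x₀ 1)))
    (hwL2 : MemLp wL 2 (volume.restrict (ball x₀ 1)))
    (hlayer : ∀ n, eLpNorm (w n - heatTest ν (a n) t) 2 (volume.restrict (ball x₀ 1)) ≤ B) :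
    eLpNorm (wL - heatTest ν aL t) 2 (volume.restrict (ball x₀ 1)) ≤ B := by
  set S : Opens ℝ³ := ⟨ball x₀ 1, isOpen_ball⟩ with hS
  set μB : Measure ℝ³ := volume.restrict (ball x₀ 1) with hμB
  -- the caloric extensions, in `L²` of the ball
  have hWn : ∀ n, MemLp (heatTest ν (a n) t) 2 μB := fun n => by
    obtain ⟨g', h', hg', hh', hae⟩ := ha n
    exact memLp_two_heatTest_restrict_ball_of_ae_eq_add hν ht hg' hh' hae x₀
  have hWL : MemLp (heatTest ν aL t) 2 μB := by
    obtain ⟨g', h', hg', hh', hae⟩ := haL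
    exact memLp_two_heatTest_restrict_ball_of_ae_eq_add hν ht hg' hh' hae x₀
  have hfL : MemLp (wL - heatTest ν aL t) 2 μB := hwL2.sub hWL
  rw [← ENNReal.ofReal_coe_nnreal]
  refine eLpNorm_two_le_of_forall_isTestFunctionOn S hfL B.coe_nonneg fun g hg => ?_
  have hgtop : FunctionSpaces.IsTestFunctionOn (⊤ : Opens ℝ³) g := hg.mono le_top
  have hg2 : MemLp g 2 μB :=
    (hg.contDiff.continuous.memLp_of_hasCompactSupport hg.hasCompactSupport).restrict _
  have hsupp : tsupport g ⊆ ball x₀ 1 := hg.tsupport_subset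
  -- the pairing of a difference, as a ball integral
  have hpair : ∀ {f₁ f₂ : ℝ³ → ℝ³}, MemLp f₁ 2 μB → MemLp f₂ 2 μB →
      ∫ x, ⟪(f₁ - f₂) x, g x⟫ = (∫ x, ⟪f₁ x, g x⟫) - ∫ x, ⟪f₂ x, g x⟫ := by
    intro f₁ f₂ h₁ h₂
    rw [integral_inner_eq_setIntegral_of_tsupport_subset _ hsupp,
      integral_inner_eq_setIntegral_of_tsupport_subset _ hsupp,
      integral_inner_eq_setIntegral_of_tsupport_subset _ hsupp,
      ← integral_sub (integrable_inner_of_memLp_conj h₁ hg2) (integrable_inner_of_memLp_conj h₂ hg2)]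
    refine integral_congr_ae (Eventually.of_forall fun x => ?_)
    simp only [Pi.sub_apply, inner_sub_left]
  -- the approximating pairings are bounded by `B ‖g‖`
  have hbd : ∀ n, |∫ x, ⟪(w n - heatTest ν (a n) t) x, g x⟫| ≤ (B : ℝ) * (eLpNorm g 2 μB).toReal := by
    intro n
    rw [integral_inner_eq_setIntegral_of_tsupport_subset _ hsupp]
    refine (FunctionSpaces.abs_integral_inner_le_eLpNorm_two_mul ((hw2 n).sub (hWn n)) hg2).trans ?_
    refine mul_le_mul_of_nonneg_right ?_ ENNReal.toReal_nonneg
    have := ENNReal.toReal_mono ENNReal.coe_ne_top (hlayer n)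
    rwa [ENNReal.coe_toReal] at this
  -- and converge to the limit pairing
  have hlim : Tendsto (fun n => ∫ x, ⟪(w n - heatTest ν (a n) t) x, g x⟫) atTop
      (𝓝 (∫ x, ⟪(wL - heatTest ν aL t) x, g x⟫)) := by
    have e : (fun n => ∫ x, ⟪(w n - heatTest ν (a n) t) x, g x⟫) =
        fun n => (∫ x, ⟪w n x, g x⟫) - ∫ x, ⟪heatTest ν (a n) t x, g x⟫ :=
      funext fun n => hpair (hw2 n) (hWn n)
    rw [e, hpair hwL2 hWL]
    exact (hconv g hgtop).sub
      (tendsto_integral_inner_heatTest_of_ae_eq_add hAtop ha haA haL haLA hconv0 hν ht hgtop)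
  exact le_of_tendsto ((continuous_abs.tendsto _).comp hlim) (Eventually.of_forall hbd)

/-! ### The initial condition of the limit -/

/-- **The initial condition of the limit, datum in `L² + L⁴`** (Lemarié-Rieusset 2016, p. 571:
"`lim_{t→0⁺} ‖v_∞(t,.) − v_∞(0,.)‖_{L²_uloc} = 0`", with the strong continuity of the heat
semigroup on `L²` and on `L⁴` in place of `L³`): if `‖u(t) − W_{νt} * aL‖_{L²(B(x₀,1))} ≤ η(t) → 0`
uniformly in `x₀` and `aL = g + h` a.e. with `g ∈ L²`, `h ∈ L⁴`, then `∫_K |u(t) − aL|² → 0` as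
`t → 0⁺` for every compact `K` (on each unit ball
`‖u(t) − aL‖₂ ≤ η(t) + ‖W_{νt} * g − g‖₂ + |B₁|^{1/4}‖W_{νt} * h − h‖₄`). [cite: LemarieRieusset2016, proof of Thm. 15.5, p. 571] -/
theorem tendsto_lintegral_sub_datum_of_layer_of_ae_eq_add {ν T : ℝ} (hν : 0 < ν) (hT : 0 < T)
    {η : ℝ → ℝ≥0} (hη : Tendsto η (𝓝[>] 0) (𝓝 0)) {aL g h : ℝ³ → ℝ³}
    {u : ℝ → ℝ³ → ℝ³} (hg : MemLp g 2 volume) (hh : MemLp h 4 volume)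
    (hae : aL =ᵐ[volume] g + h)
    (hmeas : ∀ t ∈ Ioo 0 T, AEStronglyMeasurable (u t) volume)
    (hlayer : ∀ t ∈ Ioo 0 T, ∀ x₀ : ℝ³,
      eLpNorm (u t - heatTest ν aL t) 2 (volume.restrict (ball x₀ 1)) ≤ η t)
    {K : Set ℝ³} (hK : IsCompact K) :
    Tendsto (fun t => ∫⁻ x in K, ‖u t x - aL x‖ₑ ^ 2) (𝓝[>] 0) (𝓝 0) := by
  obtain ⟨F, hF⟩ := exists_finset_subset_biUnion_ball_one hK
  -- the volume of the unit ball and the Hölder factor `|B₁|^{1/4}`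
  set V : ℝ≥0∞ := volume (ball (0 : ℝ³) 1) with hV
  have hVtop : V ≠ ∞ := measure_ball_lt_top.ne
  set r : ℝ := 1 / (2 : ℝ≥0∞).toReal - 1 / (4 : ℝ≥0∞).toReal with hr
  have hr0 : 0 ≤ r := by rw [hr, ENNReal.toReal_ofNat, ENNReal.toReal_ofNat]; norm_num
  set Vr : ℝ≥0∞ := V ^ r with hVr
  have hVrtop : Vr ≠ ∞ := ENNReal.rpow_ne_top_of_nonneg hr0 hVtop
  -- strong continuity of the heat semigroup on `L²` and on `L⁴`
  set E₂ : ℝ → ℝ≥0∞ := fun t => eLpNorm (heatTest ν g t - g) 2 volume with hE₂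
  set E₄ : ℝ → ℝ≥0∞ := fun t => eLpNorm (heatTest ν h t - h) 4 volume with hE₄
  have hνt : Tendsto (fun t : ℝ => ν * t) (𝓝[>] 0) (𝓝[≥] 0) := by
    refine tendsto_nhdsWithin_of_tendsto_nhds_of_eventually_within _ ?_ ?_
    · have hc : Continuous fun t : ℝ => ν * t := continuous_const.mul continuous_id
      have := (hc.tendsto (0 : ℝ)).mono_left (nhdsWithin_le_nhds (s := Ioi (0 : ℝ)))
      simpa using this
    · filter_upwards [self_mem_nhdsWithin] with t ht
      exact mul_nonneg hν.le (le_of_lt ht)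
  have hE₂0 : Tendsto E₂ (𝓝[>] 0) (𝓝 0) := by
    have h1 : Tendsto (fun s : ℝ => eLpNorm (heatFlow g s - g) 2 volume) (𝓝[≥] 0) (𝓝 0) :=
      tendsto_heatFlow_nhdsWithin_zero_holds hg (by norm_num) (by norm_num)
    exact h1.comp hνt
  have hE₄0 : Tendsto E₄ (𝓝[>] 0) (𝓝 0) := by
    have h1 : Tendsto (fun s : ℝ => eLpNorm (heatFlow h s - h) 4 volume) (𝓝[≥] 0) (𝓝 0) :=
      tendsto_heatFlow_nhdsWithin_zero_holds hh (by norm_num) (by norm_num)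
    exact h1.comp hνt
  -- the bound on each unit ball, for `t ∈ (0, T)`
  have hball : ∀ t ∈ Ioo (0 : ℝ) T, ∀ c : ℝ³,
      ∫⁻ x in ball c 1, ‖u t x - aL x‖ₑ ^ 2 ≤ ((η t : ℝ≥0∞) + (E₂ t + E₄ t * Vr)) ^ 2 := by
    intro t ht c
    set μc : Measure ℝ³ := volume.restrict (ball c 1) with hμc
    have hW2 : MemLp (heatTest ν g t) 2 volume := memLp_heatFlow_holds hg one_le_two (mul_nonneg hν.le ht.1.le)
    have hW4 : MemLp (heatTest ν h t) 4 volume := memLp_heatFlow_holds hh (by norm_num) (mul_nonneg hν.le ht.1.le)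
    have hWa : heatTest ν aL t = heatTest ν g t + heatTest ν h t :=
      heatTest_eq_add_of_ae_eq_add_memLp hν ht.1 one_le_two (by norm_num) hg hh hae
    have hWam : AEStronglyMeasurable (heatTest ν aL t) volume := by
      rw [hWa]; exact hW2.1.add hW4.1
    have hm1 : AEStronglyMeasurable (u t - heatTest ν aL t) μc := ((hmeas t ht).sub hWam).restrict
    have hm2 : AEStronglyMeasurable (heatTest ν g t - g) μc := (hW2.1.sub hg.1).restrict
    have hm4 : AEStronglyMeasurable (heatTest ν h t - h) μc := (hW4.1.sub hh.1).restrict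
    -- `u t − aL = (u t − W aL) + (W g − g) + (W h − h)` a.e.
    have hsplit : u t - aL =ᵐ[μc]
        (u t - heatTest ν aL t) + ((heatTest ν g t - g) + (heatTest ν h t - h)) := by
      have hae' : ∀ᵐ x ∂μc, aL x = (g + h) x := ae_restrict_of_ae hae
      filter_upwards [hae'] with x hx
      simp only [Pi.sub_apply, Pi.add_apply, hWa]
      rw [hx, Pi.add_apply]
      abel
    have h1 : eLpNorm (u t - aL) 2 μc ≤ (η t : ℝ≥0∞) + (E₂ t + E₄ t * Vr) := by
      rw [eLpNorm_congr_ae hsplit]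
      refine (eLpNorm_add_le hm1 (hm2.add hm4) one_le_two).trans (add_le_add (hlayer t ht c) ?_)
      refine (eLpNorm_add_le hm2 hm4 one_le_two).trans (add_le_add ?_ ?_)
      · exact eLpNorm_mono_measure _ Measure.restrict_le_self
      · calc eLpNorm (heatTest ν h t - h) 2 μc
            ≤ eLpNorm (heatTest ν h t - h) 4 μc * μc univ ^ r :=
              eLpNorm_le_eLpNorm_mul_rpow_measure_univ (by norm_num) hm4
          _ ≤ E₄ t * Vr := by
              have hμ : μc univ = V := by
                rw [hμc, Measure.restrict_apply_univ, hV]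
                exact Measure.addHaar_ball_center volume c 1
              rw [hμ]
              exact mul_le_mul' (eLpNorm_mono_measure _ Measure.restrict_le_self) le_rfl
    calc ∫⁻ x in ball c 1, ‖u t x - aL x‖ₑ ^ 2 = eLpNorm (u t - aL) 2 μc ^ 2 :=
          lintegral_enorm_sq_eq_eLpNorm_two_pow μc _
      _ ≤ ((η t : ℝ≥0∞) + (E₂ t + E₄ t * Vr)) ^ 2 := by gcongr
  -- the bound on `K`
  have hKbd : ∀ t ∈ Ioo (0 : ℝ) T,
      ∫⁻ x in K, ‖u t x - aL x‖ₑ ^ 2 ≤ F.card * ((η t : ℝ≥0∞) + (E₂ t + E₄ t * Vr)) ^ 2 :=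
    fun t ht => (lintegral_mono_set hF).trans
      (lintegral_biUnion_finset_le_card_mul F _ _ fun c _ => hball t ht c)
  -- the right-hand side tends to `0`
  have hη' : Tendsto (fun t => (η t : ℝ≥0∞)) (𝓝[>] 0) (𝓝 0) := by
    have := ENNReal.tendsto_coe.2 hη
    simpa using this
  have hRHS : Tendsto (fun t => (F.card : ℝ≥0∞) * ((η t : ℝ≥0∞) + (E₂ t + E₄ t * Vr)) ^ 2)
      (𝓝[>] 0) (𝓝 0) := by
    have h1 : Tendsto (fun t => E₄ t * Vr) (𝓝[>] 0) (𝓝 0) := by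
      have := ENNReal.Tendsto.mul_const hE₄0 (Or.inr hVrtop)
      rwa [zero_mul] at this
    have h2 : Tendsto (fun t => (η t : ℝ≥0∞) + (E₂ t + E₄ t * Vr)) (𝓝[>] 0) (𝓝 0) := by
      simpa using hη'.add (hE₂0.add h1)
    have h3 : Tendsto (fun t => ((η t : ℝ≥0∞) + (E₂ t + E₄ t * Vr)) ^ 2) (𝓝[>] 0) (𝓝 0) := by
      have := ((ENNReal.continuous_pow 2).tendsto 0).comp h2
      simpa [Function.comp_def] using this
    have h4 := ENNReal.Tendsto.const_mul h3 (Or.inr (ENNReal.natCast_ne_top F.card))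
    rwa [mul_zero] at h4
  refine tendsto_of_tendsto_of_tendsto_of_le_of_le' tendsto_const_nhds hRHS
    (Eventually.of_forall fun t => bot_le) ?_
  filter_upwards [Ioo_mem_nhdsGT hT] with t ht
  exact hKbd t ht

/-! ### Weak-`L³` fields are `L² + L^∞` fields -/

/-- **A weak-`L³` field splits a.e. as `g + h` with `g ∈ L²`, `h ∈ L⁴ ∩ L^∞`**, quantitatively:
`‖g‖₂² ≤ 3W`, `‖h‖₄⁴ ≤ 4W`, `|h| ≤ 1`, `W = sup_t t³|{|a| > t}|` (Barker–Seregin–Šverák 2018,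
Lemma 2.1, at height `1`; `WeakLpQuantitative.lean`). [cite: BarkerSeregin2016, Lemma 2.1 (arXiv:1603.03211 p. 5)] -/
theorem _root_.Literature.Analysis.FunctionSpaces.MemWeakLp.exists_ae_eq_add_two_four
    {a : ℝ³ → ℝ³} (ha : FunctionSpaces.MemWeakLp a 3 volume) :
    ∃ g h : ℝ³ → ℝ³, MemLp g 2 volume ∧ MemLp h 4 volume ∧ MemLp h ∞ volume ∧
      (∀ x, ‖h x‖ ≤ 1) ∧
      ∫⁻ x, ‖g x‖ₑ ^ (2 : ℝ) ≤ 3 * FunctionSpaces.eWeakLpPow a 3 volume ∧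
      ∫⁻ x, ‖h x‖ₑ ^ (4 : ℝ) ≤ 4 * FunctionSpaces.eWeakLpPow a 3 volume ∧
      a =ᵐ[volume] g + h := by
  set f : ℝ³ → ℝ³ := ha.1.mk a with hf
  have hfm : StronglyMeasurable f := ha.1.stronglyMeasurable_mk
  have haf : a =ᵐ[volume] f := ha.1.ae_eq_mk
  have hW : FunctionSpaces.eWeakLpPow f 3 volume = FunctionSpaces.eWeakLpPow a 3 volume :=
    (FunctionSpaces.eWeakLpPow_congr_ae haf).symm
  have hWtop : FunctionSpaces.eWeakLpPow a 3 volume < ∞ := ha.2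
  have hA : MeasurableSet {x | 1 < ‖f x‖} := measurableSet_lt measurable_const hfm.norm.measurable
  have hB : MeasurableSet {x | ‖f x‖ ≤ 1} := measurableSet_le hfm.norm.measurable measurable_const
  set g : ℝ³ → ℝ³ := {x | 1 < ‖f x‖}.indicator f with hg
  set h : ℝ³ → ℝ³ := {x | ‖f x‖ ≤ 1}.indicator f with hh
  have hgm : AEStronglyMeasurable g volume := hfm.aestronglyMeasurable.indicator hA
  have hhm : AEStronglyMeasurable h volume := hfm.aestronglyMeasurable.indicator hB
  have hh1 : ∀ x, ‖h x‖ ≤ 1 := fun x => FunctionSpaces.norm_indicator_norm_le_le f zero_le_one x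
  have hg2 : ∫⁻ x, ‖g x‖ₑ ^ (2 : ℝ) ≤ 3 * FunctionSpaces.eWeakLpPow a 3 volume := by
    have h1 := FunctionSpaces.MemWeakLp.lintegral_rpow_indicator_lt_norm_le (p := 3) (μ := volume)
      hfm.aestronglyMeasurable hA (r := 2) zero_lt_two (by rw [ENNReal.toReal_ofNat]; norm_num)
      zero_lt_one
    refine h1.trans (le_of_eq ?_)
    rw [ENNReal.toReal_ofNat, Real.one_rpow, mul_one, show ((3 : ℝ) / (3 - 2)) = 3 by norm_num,
      ENNReal.ofReal_ofNat, hW]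
  have hh4 : ∫⁻ x, ‖h x‖ₑ ^ (4 : ℝ) ≤ 4 * FunctionSpaces.eWeakLpPow a 3 volume := by
    have h1 := FunctionSpaces.MemWeakLp.lintegral_rpow_indicator_norm_le_le (p := 3) (μ := volume)
      hfm.aestronglyMeasurable hB (q := 4) (by rw [ENNReal.toReal_ofNat]; norm_num) zero_lt_one
    refine h1.trans (le_of_eq ?_)
    rw [ENNReal.toReal_ofNat, Real.one_rpow, mul_one, show ((4 : ℝ) / (4 - 3)) = 4 by norm_num,
      ENNReal.ofReal_ofNat, hW]
  have hgLp : MemLp g 2 volume := by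
    refine ⟨hgm, ?_⟩
    rw [eLpNorm_eq_lintegral_rpow_enorm_toReal two_ne_zero ENNReal.ofNat_ne_top, ENNReal.toReal_ofNat]
    refine ENNReal.rpow_lt_top_of_nonneg (by norm_num) (lt_of_le_of_lt hg2 ?_).ne
    exact ENNReal.mul_lt_top (by simp) hWtop
  have hhLp : MemLp h 4 volume := by
    refine ⟨hhm, ?_⟩
    rw [eLpNorm_eq_lintegral_rpow_enorm_toReal (by norm_num) ENNReal.ofNat_ne_top, ENNReal.toReal_ofNat]
    refine ENNReal.rpow_lt_top_of_nonneg (by norm_num) (lt_of_le_of_lt hh4 ?_).ne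
    exact ENNReal.mul_lt_top (by simp) hWtop
  have hhtop : MemLp h ∞ volume := memLp_top_of_bound hhm 1 (Eventually.of_forall hh1)
  refine ⟨g, h, hgLp, hhLp, hhtop, hh1, hg2, hh4, ?_⟩
  filter_upwards [haf] with x hx
  rw [hx, FunctionSpaces.indicator_lt_norm_add_indicator_norm_le f 1]

/-- A weak-`L³` field is an `L² + L^∞` field (the form consumed by the lemmas above). [folklore] -/
theorem _root_.Literature.Analysis.FunctionSpaces.MemWeakLp.exists_ae_eq_add_two_top
    {a : ℝ³ → ℝ³} (ha : FunctionSpaces.MemWeakLp a 3 volume) :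
    ∃ g h : ℝ³ → ℝ³, MemLp g 2 volume ∧ MemLp h ∞ volume ∧ a =ᵐ[volume] g + h := by
  obtain ⟨g, h, hg, -, hh, -, -, -, hae⟩ := ha.exists_ae_eq_add_two_four
  exact ⟨g, h, hg, hh, hae⟩

/-- A weak-`L³` field is locally integrable (`L² + L^∞ ⊂ L¹_loc`). [folklore] -/
theorem _root_.Literature.Analysis.FunctionSpaces.MemWeakLp.locallyIntegrable_of_three
    {a : ℝ³ → ℝ³} (ha : FunctionSpaces.MemWeakLp a 3 volume) : LocallyIntegrable a volume := by
  obtain ⟨g, h, hg, hh, hae⟩ := ha.exists_ae_eq_add_two_top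
  have h1 : LocallyIntegrable (g + h) volume :=
    (hg.locallyIntegrable one_le_two).add (hh.locallyIntegrable le_top)
  exact h1.congr hae.symm

/-- **Unit-ball energies of weak-`L³` fields**: `∫_{B(z,1)} |a|² ≤ |B₁| + 2W`. [folklore] -/
theorem _root_.Literature.Analysis.FunctionSpaces.MemWeakLp.lintegral_ball_enorm_sq_le_of_three
    {a : ℝ³ → ℝ³} (ha : FunctionSpaces.MemWeakLp a 3 volume) (z : ℝ³) :
    ∫⁻ y in ball z 1, ‖a y‖ₑ ^ 2 ≤
      volume (ball (0 : ℝ³) 1) + 2 * FunctionSpaces.eWeakLpPow a 3 volume := by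
  have h := FunctionSpaces.MemWeakLp.setLIntegral_enorm_sq_le_of_three (μ := volume) ha.1 (ball z 1)
  rwa [Measure.addHaar_ball_center volume z 1] at h

end Literature.Analysis.FluidPDE

end
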